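import Literature.Geometry.Lorentzian.SuperharmonicInvRadius
import HarnessLib

/-!
# Schoen–Yau 1979, (2.6)–(2.7): the Hessian of the coordinate functions far out on an end

Schoen–Yau, Comm. Math. Phys. 65 (1979), §2 Step 2, (2.6)–(2.7) (pp. 50–51): on an end `N_k`
with the expansion (1.1) `g = (1 + M/2r)⁴ δ + p`, `|p| ≤ k₁ r⁻²`, `|∂p| ≤ k₂ r⁻³`, the covariant
Hessian of a function `φ` is `D_{ij} φ = ∂ᵢ∂ⱼ φ − Γˡᵢⱼ ∂ₗ φ` with
`Γˡᵢⱼ = ½ gˡᵏ(∂ᵢ g_{jk} + ∂ⱼ g_{ik} − ∂ₖ g_{ij})` (2.6), and *"by direct calculation using (1.1)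
and (2.6) we have"* (2.7)
`D_{ij} x³ = (M/r³)(xⁱ δ_{j3} + xʲ δ_{i3} − x³ δ_{ij}) + O(r⁻³)`.
This is the input of the height estimate (2.5) for the minimal surfaces `S_σ` (the maximum
principle for `x³` restricted to `S_σ ∩ N_k`, p. 51).

We prove (2.7) in the coordinate calculus of `CoordCurvature.lean` /
`CoordLaplacianPerturbation.lean` (`MetricCoord.hessAt G f y`, the covariant Hessian of the
metric components `G`), for the linear functions `f = ⟪u, ·⟫` (the coordinate `xⁱ` is
`u = eᵢ`), in two steps, exactly as for (2.1) in `SuperharmonicInvRadius.lean`: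

* `MetricCoord.hessAt_schwarzschild_inner_left` — the **exact model term**: for the Schwarzschild
  components `G₀ = w⁴ δ`, `w = 1 + M/(2r)`, and `‖y‖ > |M|`,
  `Hess_{G₀} ⟪u,·⟫ (y)(X, Y) = (M / (w r³)) (⟪y,X⟫⟪u,Y⟫ + ⟪y,Y⟫⟪u,X⟫ − ⟪X,Y⟫⟪u,y⟫)`
  (the Christoffel symbols of `w⁴δ` are the conformal difference tensor,
  `IsMetricOn.chrAt_conformal_eq`, Besse 1987, Thm. 1.159 (a), with `θ = 2dw/w`,
  `dw = −(M/2) r⁻³ ⟨y, ·⟩`).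
* `AFEnd.eventually_abs_hessAt_hCoeff_inner_sub_le` — **(2.7)**: for `G = hCoeff e D` with
  `IsAsymptoticallySchwarzschild e D M 2` there is `C` with, eventually along `cobounded E3`,
  `|Hess_G ⟪u,·⟫ (y)(X,Y) − (M/r³)(⟪y,X⟫⟪u,Y⟫ + ⟪y,Y⟫⟪u,X⟫ − ⟪X,Y⟫⟪u,y⟫)| ≤ C r⁻³ ‖u‖‖X‖‖Y‖`
  (perturbation bound `norm_hessAt_sub_hessAt_apply_le`: `Hess_G f − Hess_{G₀} f = −Df ∘ (Γ − Γ₀)`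
  with `‖♯ − ♯₀‖ = O(r⁻²)`, `‖DG‖ = O(r⁻¹)`, `‖DG − DG₀‖ = O(r⁻³)`; and `1/w − 1 = O(1/r)`).

Everything is proved; no named fact and no `sorry` is introduced.

## References

* R. Schoen, S.-T. Yau, *On the proof of the positive mass conjecture in general relativity*,
  Comm. Math. Phys. 65 (1979), 45–76, §2, (2.6)–(2.7). [SchoenYauPMT1979]
* A. L. Besse, *Einstein manifolds*, Springer (1987), Thm. 1.159. [Besse1987]
-/

noncomputable section

set_option maxSynthPendingDepth 3

open Set Filter Asymptotics Bornology Metric ContinuousLinearMap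
open scoped Topology ContDiff RealInnerProductSpace Manifold

namespace Literature.Geometry.Lorentzian

open MetricCoord

namespace MetricCoord

section Flat

variable {E : Type*} [NormedAddCommGroup E] [InnerProductSpace ℝ E] [FiniteDimensional ℝ E]
  {δ : E →L[ℝ] E →L[ℝ] ℝ} (hδ : ∀ v w : E, δ v w = ⟪v, w⟫)

include hδ in
/-- **The Hessian of a linear function for the Schwarzschild conformal factor** (the model term
of Schoen–Yau 1979, (2.7)): with `w = 1 + M/(2r)` and `‖y‖ > |M|`,
`Hess_{w⁴δ} ⟪u,·⟫ (y)(X,Y) = (M/(w(y) ‖y‖³)) (⟪y,X⟫⟪u,Y⟫ + ⟪y,Y⟫⟪u,X⟫ − ⟪X,Y⟫⟪u,y⟫)`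
— `D²⟪u,·⟫ = 0`, the Christoffel symbols of `w⁴ δ` are the conformal difference tensor
`C(X,Y) = θ(X)Y + θ(Y)X − ⟪X,Y⟫ θ♯` with `θ = 2 dw / w = −(M/(w r³)) ⟨y,·⟩`
(Besse 1987, Thm. 1.159 (a)). [cite: SchoenYauPMT1979, §2 Step 2, (2.6)–(2.7) (pp. 50–51)]
[cite: Besse1987, Thm. 1.159 (a)] -/
theorem hessAt_schwarzschild_inner_left (M : ℝ) {y : E} (hy : |M| < ‖y‖) (u X Y : E) :
    hessAt (fun z : E ↦ (1 + M / (2 * ‖z‖)) ^ 4 • δ) (fun z : E ↦ ⟪u, z⟫) y X Y =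
      M * (1 + M / (2 * ‖y‖))⁻¹ * (‖y‖ ^ 3)⁻¹ *
        (⟪y, X⟫ * ⟪u, Y⟫ + ⟪y, Y⟫ * ⟪u, X⟫ - ⟪X, Y⟫ * ⟪u, y⟫) := by
  -- the open set `{|M| < ‖z‖}`, on which `w = 1 + M/(2r) > 0` is smooth
  set V : Set E := {z | |M| < ‖z‖} with hV
  have hVo : IsOpen V := isOpen_lt continuous_const continuous_norm
  have hne : ∀ z ∈ V, z ≠ 0 := fun z hz ↦ by
    rintro rfl
    have hz' : |M| < ‖(0 : E)‖ := hz
    rw [norm_zero] at hz'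
    linarith [abs_nonneg M]
  have hwpos : ∀ z ∈ V, 0 < 1 + M / (2 * ‖z‖) := fun z hz ↦ by
    have hz' : |M| < ‖z‖ := hz
    have hzpos : 0 < ‖z‖ := (abs_nonneg M).trans_lt hz'
    have : |M / (2 * ‖z‖)| < 1 := by
      rw [abs_div, abs_of_pos (by positivity : (0 : ℝ) < 2 * ‖z‖), div_lt_one (by positivity)]
      linarith
    linarith [neg_abs_le (M / (2 * ‖z‖))]
  have hnorm : ContDiffOn ℝ ∞ (fun z : E ↦ ‖z‖) V := fun z hz ↦
    (contDiffAt_norm ℝ (hne z hz)).contDiffWithinAt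
  have hw : ContDiffOn ℝ ∞ (fun z : E ↦ 1 + M / (2 * ‖z‖)) V :=
    contDiffOn_const.add (contDiffOn_const.div (contDiffOn_const.mul hnorm)
      fun z hz ↦ mul_ne_zero two_ne_zero (norm_ne_zero_iff.2 (hne z hz)))
  have hG : IsMetricOn (fun _ : E ↦ δ) V := isMetricOn_const_inner hδ hVo
  have hc : ContDiffOn ℝ ∞ (fun z : E ↦ (1 + M / (2 * ‖z‖)) ^ 4) V := hw.pow 4
  have hc0 : ∀ z ∈ V, (1 + M / (2 * ‖z‖)) ^ 4 ≠ 0 := fun z hz ↦ pow_ne_zero 4 (hwpos z hz).ne'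
  have hy0 : y ≠ 0 := hne y hy
  have hwy : 1 + M / (2 * ‖y‖) ≠ 0 := (hwpos y hy).ne'
  have hwd : DifferentiableAt ℝ (fun z : E ↦ 1 + M / (2 * ‖z‖)) y :=
    hG.differentiableAt_of_contDiffOn hw hy
  -- the linear function and its derivatives
  have hf : (fun z : E ↦ ⟪u, z⟫) = fun z ↦ (innerSL ℝ u : E →L[ℝ] ℝ) z := by
    funext z; rfl
  have hDf : fderiv ℝ (fun z : E ↦ ⟪u, z⟫) = fun _ ↦ (innerSL ℝ u : E →L[ℝ] ℝ) := by
    rw [hf]; funext z; exact (innerSL ℝ u : E →L[ℝ] ℝ).fderiv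
  have hD2f : fderiv ℝ (fderiv ℝ (fun z : E ↦ ⟪u, z⟫)) y = 0 := by
    rw [hDf]; exact fderiv_const_apply _
  -- the conformal one-form `θ = 2 dw / w` with `dw = -(M/2) r⁻³ ⟨y, ·⟩`
  have hDu : fderiv ℝ (fun z : E ↦ ‖z‖⁻¹) y = (-(‖y‖ ^ 3)⁻¹) • (innerSL ℝ y : E →L[ℝ] ℝ) :=
    (hasFDerivAt_inv_norm hy0).fderiv
  have hDw : fderiv ℝ (fun z : E ↦ 1 + M / (2 * ‖z‖)) y =
      (M / 2) • fderiv ℝ (fun z : E ↦ ‖z‖⁻¹) y := by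
    have h := ((hasFDerivAt_inv_norm hy0).const_mul (M / 2)).const_add 1
    rw [hDu]
    refine (HasFDerivAt.fderiv (h.congr_of_eventuallyEq (Filter.Eventually.of_forall fun z ↦ ?_)))
    simp only [div_eq_mul_inv, mul_inv]
    ring
  have hθ : confForm (fun z : E ↦ (1 + M / (2 * ‖z‖)) ^ 4) y =
      (2 * (1 + M / (2 * ‖y‖))⁻¹) • fderiv ℝ (fun z : E ↦ 1 + M / (2 * ‖z‖)) y :=
    confForm_fourth_power hwd hwy
  have hΓ : chrAt (fun z : E ↦ (1 + M / (2 * ‖z‖)) ^ 4 • δ) y X Y =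
      confDiff (fun _ : E ↦ δ) (fun z : E ↦ (1 + M / (2 * ‖z‖)) ^ 4) y X Y := by
    rw [hG.chrAt_conformal_eq hc hc0 hy, chrAt_const, _root_.zero_apply, _root_.zero_apply,
      zero_add]
  -- `Df(T) = θ(u)` (Riesz)
  have hT : (innerSL ℝ u : E →L[ℝ] ℝ)
      (confVec (fun _ : E ↦ δ) (fun z : E ↦ (1 + M / (2 * ‖z‖)) ^ 4) y) =
      confForm (fun z : E ↦ (1 + M / (2 * ‖z‖)) ^ 4) y u := by
    rw [confVec, innerSL_apply_apply, real_inner_comm, inner_sharpAt_const_inner hδ]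
  rw [hessAt_apply, hD2f, hΓ, confDiff, hDf]
  simp only [_root_.zero_apply, zero_sub, map_add, map_sub, map_smul, smul_eq_mul]
  rw [hT]
  simp only [hθ, hDw, hDu, _root_.smul_apply, smul_eq_mul, innerSL_apply_apply, hδ]
  have hyn : ‖y‖ ≠ 0 := norm_ne_zero_iff.2 hy0
  rw [real_inner_comm u y]
  field_simp
  ring

end Flat

end MetricCoord

namespace AFEnd

variable {X : Type} [TopologicalSpace X] [ChartedSpace E3 X] [IsManifold (𝓡 3) ∞ X]
  (e : AFEnd X) (D : InitialDataSet (𝓡 3) X)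

set_option maxHeartbeats 800000 in
/-- **Schoen–Yau 1979, (2.7): the Hessian of the coordinate functions far out on an end**,
coordinate form. If the chart components `G = hCoeff e D` have the expansion (1.1) with mass `M`
(`IsAsymptoticallySchwarzschild e D M 2`), then there is a constant `C` with, eventually along
`cobounded E3`, for all `u X Y : E3`,
`|Hess_G ⟪u,·⟫ (y)(X,Y) − (M/‖y‖³)(⟪y,X⟫⟪u,Y⟫ + ⟪y,Y⟫⟪u,X⟫ − ⟪X,Y⟫⟪u,y⟫)| ≤ C ‖y‖⁻³ ‖u‖‖X‖‖Y‖`.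
Printed (with `u = e₃`): "`D_{ij} x³ = (M/r³)(xⁱδ_{j3} + xʲδ_{i3} − x³δ_{ij}) + O(r⁻³)`".
[cite: SchoenYauPMT1979, §2 Step 2, (2.7) (p. 51)] -/
theorem eventually_abs_hessAt_hCoeff_inner_sub_le {M : ℝ}
    (hAS : IsAsymptoticallySchwarzschild e D M 2) :
    ∃ C : ℝ, 0 ≤ C ∧ ∀ᶠ y in cobounded E3, ∀ u X Y : E3,
      |hessAt (hCoeff e D) (fun z : E3 ↦ ⟪u, z⟫) y X Y
          - M * (‖y‖ ^ 3)⁻¹ * (⟪y, X⟫ * ⟪u, Y⟫ + ⟪y, Y⟫ * ⟪u, X⟫ - ⟪X, Y⟫ * ⟪u, y⟫)|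
        ≤ C * (‖y‖ ^ 3)⁻¹ * ‖u‖ * ‖X‖ * ‖Y‖ := by
  -- notation
  set δ : E3 →L[ℝ] E3 →L[ℝ] ℝ := (innerSL ℝ : E3 →L[ℝ] E3 →L[ℝ] ℝ) with hδdef
  have hδ : ∀ v w : E3, δ v w = ⟪v, w⟫ := fun v w ↦ rfl
  set G : E3 → E3 →L[ℝ] E3 →L[ℝ] ℝ := hCoeff e D with hGdef
  set w : E3 → ℝ := fun y ↦ 1 + M / (2 * ‖y‖) with hwdef
  set G₀ : E3 → E3 →L[ℝ] E3 →L[ℝ] ℝ := fun y ↦ w y ^ 4 • δ with hG₀def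
  -- (1.1): `G - G₀ = O(r⁻²)`, `∂(G - G₀) = O(r⁻³)`
  have hO0 := hAS 0 (by norm_num)
  have hO1 := hAS 1 (by norm_num)
  simp only [Nat.cast_zero, sub_zero, Nat.cast_one] at hO0 hO1
  have hO0' : (fun x ↦ ‖G x - G₀ x‖) =O[cobounded E3] fun x ↦ ‖x‖ ^ (-(2 : ℕ) : ℝ) := by
    refine (hO0.congr_left fun x ↦ ?_).congr_right fun x ↦ by norm_num
    rw [norm_iteratedFDeriv_zero]
  have hO1' : (fun x ↦ ‖fderiv ℝ (fun y ↦ G y - G₀ y) x‖) =O[cobounded E3]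
      fun x ↦ ‖x‖ ^ (-(3 : ℕ) : ℝ) := by
    refine (hO1.congr_left fun x ↦ ?_).congr_right fun x ↦ by norm_num
    rw [norm_iteratedFDeriv_one]
  obtain ⟨C₀, hC₀, hev0⟩ := exists_pos_eventually_le_of_isBigO (fun x ↦ norm_nonneg _) hO0'
  obtain ⟨C₁, hC₁, hev1⟩ := exists_pos_eventually_le_of_isBigO (fun x ↦ norm_nonneg _) hO1'
  -- `G - G₀ → 0`
  have htend : Tendsto (fun x ↦ ‖G x - G₀ x‖) (cobounded E3) (𝓝 0) := by
    refine hO0'.trans_tendsto ?_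
    have h := (tendsto_rpow_neg_atTop (by norm_num : (0 : ℝ) < 2)).comp
      (tendsto_norm_cobounded_atTop (E := E3))
    refine h.congr fun x ↦ ?_
    simp only [Function.comp_apply, Nat.cast_ofNat]
  have hev_small : ∀ᶠ x in cobounded E3, ‖G x - G₀ x‖ ≤ 16⁻¹ :=
    (htend.eventually (ge_mem_nhds (by norm_num : (0 : ℝ) < 16⁻¹)))
  -- the symbol `w⁴ = (1 + M/2r)⁴`: smooth far out with `‖D(w⁴)‖ = O(r⁻¹)`
  have hw4 : IsBigOSmooth 2 0 fun y : E3 ↦ w y ^ 4 := by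
    have h := ((isBigOSmooth_const_add_mul_inv_norm (E := E3) 1 (M / 2)).pow 4)
    refine h.congr fun y ↦ ?_
    simp only [hwdef, div_eq_mul_inv, mul_inv]
    ring
  obtain ⟨R₀, hR₀⟩ := hw4.eventually_contDiffAt
  have hOw : (fun x ↦ ‖fderiv ℝ (fun y : E3 ↦ w y ^ 4) x‖) =O[cobounded E3]
      fun x ↦ ‖x‖ ^ (-(1 : ℕ) : ℝ) := by
    refine ((hw4.isBigO (m := 1) (by norm_num)).congr_left fun x ↦ ?_).congr_right
      fun x ↦ by norm_num
    rw [norm_iteratedFDeriv_one]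
  obtain ⟨C₂, hC₂, hev2⟩ := exists_pos_eventually_le_of_isBigO (fun x ↦ norm_nonneg _) hOw
  -- the constant
  set K : ℝ := 6 * C₀ * (C₂ + C₁) + 3 * C₁ + 3 * M ^ 2 with hKdef
  refine ⟨K, by positivity, ?_⟩
  filter_upwards [hev0, hev1, hev_small, hev2, eventually_cobounded_lt_norm (E := E3) e.R,
    eventually_cobounded_lt_norm (E := E3) R₀,
    eventually_cobounded_le_norm (E := E3) (max 1 (4 * |M|))]
    with y hy0 hy1 hysmall hy2 hyR hyR₀ hybig u X Y
  have hy1' : 1 ≤ ‖y‖ := le_trans (le_max_left _ _) hybig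
  have hyM : 4 * |M| ≤ ‖y‖ := le_trans (le_max_right _ _) hybig
  have hypos : 0 < ‖y‖ := by linarith
  have hy_ne : y ≠ 0 := norm_pos_iff.1 hypos
  have hMy : |M| < ‖y‖ := by linarith [abs_nonneg M]
  -- `w` between `7/8` and `1 + 1/8`
  have hw_ge : 7 / 8 ≤ w y := by
    simp only [hwdef]
    have h1 : -|M| ≤ M := neg_abs_le M
    have h2 : M / (2 * ‖y‖) ≥ -(8⁻¹) := by
      rw [ge_iff_le, le_div_iff₀ (by positivity)]
      linarith
    linarith
  have hwpos : 0 < w y := by linarith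
  have hw4_ge : 58 / 100 ≤ w y ^ 4 := by
    have h := pow_le_pow_left₀ (by norm_num : (0 : ℝ) ≤ 7 / 8) hw_ge 4
    norm_num at h
    linarith
  -- differentiability at `y`
  have hGd : DifferentiableAt ℝ G y := (e.contDiffAt_hCoeff D hyR).differentiableAt (by simp)
  have hw4d : DifferentiableAt ℝ (fun z : E3 ↦ w z ^ 4) y := (hR₀ y hyR₀).differentiableAt (by simp)
  obtain ⟨hG₀d, hG₀n⟩ := differentiableAt_smul_const_norm_le hw4d δ
  have hDG₀ : ‖fderiv ℝ G₀ y‖ ≤ C₂ * (‖y‖ ^ 1)⁻¹ := by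
    calc ‖fderiv ℝ G₀ y‖ ≤ ‖fderiv ℝ (fun z : E3 ↦ w z ^ 4) y‖ * ‖δ‖ := hG₀n
      _ ≤ ‖fderiv ℝ (fun z : E3 ↦ w z ^ 4) y‖ * 1 := by
          gcongr; exact norm_innerSL_bilin_le_one
      _ ≤ C₂ * (‖y‖ ^ 1)⁻¹ := by rw [mul_one]; exact hy2
  have hsplit : fderiv ℝ (fun z ↦ G z - G₀ z) y = fderiv ℝ G y - fderiv ℝ G₀ y :=
    fderiv_fun_sub hGd hG₀d
  rw [hsplit] at hy1
  have hr1 : (‖y‖ ^ 3)⁻¹ ≤ (‖y‖ ^ 1)⁻¹ := by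
    rw [pow_one]
    exact inv_anti₀ hypos (le_self_pow₀ hy1' three_ne_zero)
  have hDG : ‖fderiv ℝ G y‖ ≤ (C₂ + C₁) * (‖y‖ ^ 1)⁻¹ := by
    have h : ‖fderiv ℝ G y‖ ≤ ‖fderiv ℝ G₀ y‖ + ‖fderiv ℝ G y - fderiv ℝ G₀ y‖ := by
      have := norm_add_le (fderiv ℝ G₀ y) (fderiv ℝ G y - fderiv ℝ G₀ y)
      rwa [add_sub_cancel] at this
    have h' : ‖fderiv ℝ G y - fderiv ℝ G₀ y‖ ≤ C₁ * (‖y‖ ^ 1)⁻¹ :=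
      hy1.trans (mul_le_mul_of_nonneg_left hr1 hC₁.le)
    linarith
  -- coercivity and the inverses
  have hcoer : ∀ v : E3, 2⁻¹ * ‖v‖ ^ 2 ≤ G y v v := fun v ↦ by
    have h1 : G y v v = G₀ y v v + (G y - G₀ y) v v := by
      simp only [_root_.sub_apply]; ring
    have h2 : G₀ y v v = w y ^ 4 * ‖v‖ ^ 2 := by
      rw [hG₀def, smul_clm_apply₂, hδ, real_inner_self_eq_norm_sq]
    have h3 : |(G y - G₀ y) v v| ≤ 16⁻¹ * ‖v‖ ^ 2 := by
      calc |(G y - G₀ y) v v| ≤ ‖(G y - G₀ y) v‖ * ‖v‖ := by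
            rw [← Real.norm_eq_abs]; exact le_opNorm _ _
        _ ≤ ‖G y - G₀ y‖ * ‖v‖ * ‖v‖ := by gcongr; exact le_opNorm _ _
        _ ≤ 16⁻¹ * ‖v‖ * ‖v‖ := by gcongr
        _ = 16⁻¹ * ‖v‖ ^ 2 := by ring
    have h4 := neg_abs_le ((G y - G₀ y) v v)
    have h5 := mul_le_mul_of_nonneg_right hw4_ge (sq_nonneg ‖v‖)
    rw [h1, h2]
    linarith [sq_nonneg ‖v‖]
  have hcoer₀ : ∀ v : E3, 2⁻¹ * ‖v‖ ^ 2 ≤ G₀ y v v := fun v ↦ by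
    have h2 : G₀ y v v = w y ^ 4 * ‖v‖ ^ 2 := by
      rw [hG₀def, smul_clm_apply₂, hδ, real_inner_self_eq_norm_sq]
    have h5 := mul_le_mul_of_nonneg_right hw4_ge (sq_nonneg ‖v‖)
    rw [h2]
    linarith [sq_nonneg ‖v‖]
  have hinv : (G y).IsInvertible := isInvertible_of_nondegenerate fun v hv ↦ by
    have h := hcoer v
    rw [hv v] at h
    have : ‖v‖ ^ 2 ≤ 0 := by linarith
    exact norm_eq_zero.1 (pow_eq_zero_iff two_ne_zero |>.1 (le_antisymm this (sq_nonneg _)))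
  have hinv₀ : (G₀ y).IsInvertible := isInvertible_of_nondegenerate fun v hv ↦ by
    have h := hcoer₀ v
    rw [hv v] at h
    have : ‖v‖ ^ 2 ≤ 0 := by linarith
    exact norm_eq_zero.1 (pow_eq_zero_iff two_ne_zero |>.1 (le_antisymm this (sq_nonneg _)))
  have hS₀ : ‖sharpAt G₀ y‖ ≤ 2 := by
    have := norm_sharpAt_le_of_coercive hinv₀ (by norm_num : (0 : ℝ) < 2⁻¹) hcoer₀
    norm_num at this
    exact this
  have hA : ‖sharpAt G y - sharpAt G₀ y‖ ≤ 4 * C₀ * (‖y‖ ^ 2)⁻¹ := by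
    have hS : ‖sharpAt G y‖ ≤ 2 := by
      have := norm_sharpAt_le_of_coercive hinv (by norm_num : (0 : ℝ) < 2⁻¹) hcoer
      norm_num at this
      exact this
    refine (norm_sharpAt_sub_sharpAt_le hinv hinv₀).trans ?_
    calc ‖sharpAt G y‖ * ‖G y - G₀ y‖ * ‖sharpAt G₀ y‖ ≤ 2 * (C₀ * (‖y‖ ^ 2)⁻¹) * 2 := by
          gcongr
      _ = 4 * C₀ * (‖y‖ ^ 2)⁻¹ := by ring
  -- the derivative of the linear function `f = ⟪u, ·⟫`
  set f : E3 → ℝ := fun z ↦ ⟪u, z⟫ with hfdef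
  have hDf : fderiv ℝ f y = (innerSL ℝ u : E3 →L[ℝ] ℝ) := by
    have hf : f = fun z ↦ (innerSL ℝ u : E3 →L[ℝ] ℝ) z := by funext z; rfl
    rw [hf]; exact (innerSL ℝ u : E3 →L[ℝ] ℝ).fderiv
  have hDfn : ‖fderiv ℝ f y‖ ≤ ‖u‖ := by
    rw [hDf, innerSL_apply_norm]
  -- the perturbation bound `|Hess_G f − Hess_{G₀} f| ≤ (6 C₀ (C₂ + C₁) + 3 C₁) r⁻³ ‖u‖‖X‖‖Y‖`
  have hpert : |hessAt G f y X Y - hessAt G₀ f y X Y| ≤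
      (6 * C₀ * (C₂ + C₁) + 3 * C₁) * (‖y‖ ^ 3)⁻¹ * ‖u‖ * ‖X‖ * ‖Y‖ := by
    have h1 : |hessAt G f y X Y - hessAt G₀ f y X Y| ≤
        ‖hessAt G f y X - hessAt G₀ f y X‖ * ‖Y‖ := by
      rw [← Real.norm_eq_abs, ← _root_.sub_apply]
      exact le_opNorm _ _
    have h2 := norm_hessAt_sub_hessAt_apply_le (G := G) (G₀ := G₀) (y := y) f X
    have h3 : ‖fderiv ℝ f y‖ * (2⁻¹ * (3 * (‖sharpAt G y - sharpAt G₀ y‖ * ‖fderiv ℝ G y‖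
        + ‖sharpAt G₀ y‖ * ‖fderiv ℝ G y - fderiv ℝ G₀ y‖) * ‖X‖)) ≤
        ‖u‖ * (2⁻¹ * (3 * (4 * C₀ * (‖y‖ ^ 2)⁻¹ * ((C₂ + C₁) * (‖y‖ ^ 1)⁻¹)
          + 2 * (C₁ * (‖y‖ ^ 3)⁻¹)) * ‖X‖)) := by
      gcongr
    have h4 : ‖u‖ * (2⁻¹ * (3 * (4 * C₀ * (‖y‖ ^ 2)⁻¹ * ((C₂ + C₁) * (‖y‖ ^ 1)⁻¹)
          + 2 * (C₁ * (‖y‖ ^ 3)⁻¹)) * ‖X‖)) =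
        (6 * C₀ * (C₂ + C₁) + 3 * C₁) * (‖y‖ ^ 3)⁻¹ * ‖u‖ * ‖X‖ := by
      field_simp
      ring
    calc |hessAt G f y X Y - hessAt G₀ f y X Y|
        ≤ ‖hessAt G f y X - hessAt G₀ f y X‖ * ‖Y‖ := h1
      _ ≤ (6 * C₀ * (C₂ + C₁) + 3 * C₁) * (‖y‖ ^ 3)⁻¹ * ‖u‖ * ‖X‖ * ‖Y‖ := by
          rw [← h4]
          exact mul_le_mul_of_nonneg_right (h2.trans h3) (norm_nonneg _)
  -- the exact model term and `1/w - 1 = O(1/r)`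
  set P : ℝ := ⟪y, X⟫ * ⟪u, Y⟫ + ⟪y, Y⟫ * ⟪u, X⟫ - ⟪X, Y⟫ * ⟪u, y⟫ with hPdef
  have hflat : hessAt G₀ f y X Y = M * (w y)⁻¹ * (‖y‖ ^ 3)⁻¹ * P :=
    hessAt_schwarzschild_inner_left hδ M hMy u X Y
  have hP : |P| ≤ 3 * ‖y‖ * ‖u‖ * ‖X‖ * ‖Y‖ := by
    have h1 : |⟪y, X⟫ * ⟪u, Y⟫| ≤ ‖y‖ * ‖X‖ * (‖u‖ * ‖Y‖) := by
      rw [abs_mul]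
      exact mul_le_mul (abs_real_inner_le_norm _ _) (abs_real_inner_le_norm _ _) (abs_nonneg _)
        (by positivity)
    have h2 : |⟪y, Y⟫ * ⟪u, X⟫| ≤ ‖y‖ * ‖Y‖ * (‖u‖ * ‖X‖) := by
      rw [abs_mul]
      exact mul_le_mul (abs_real_inner_le_norm _ _) (abs_real_inner_le_norm _ _) (abs_nonneg _)
        (by positivity)
    have h3 : |⟪X, Y⟫ * ⟪u, y⟫| ≤ ‖X‖ * ‖Y‖ * (‖u‖ * ‖y‖) := by
      rw [abs_mul]
      exact mul_le_mul (abs_real_inner_le_norm _ _) (abs_real_inner_le_norm _ _) (abs_nonneg _)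
        (by positivity)
    calc |P| ≤ |⟪y, X⟫ * ⟪u, Y⟫| + |⟪y, Y⟫ * ⟪u, X⟫| + |⟪X, Y⟫ * ⟪u, y⟫| := by
          rw [hPdef]; exact (abs_sub _ _).trans (by gcongr; exact abs_add_le _ _)
      _ ≤ ‖y‖ * ‖X‖ * (‖u‖ * ‖Y‖) + ‖y‖ * ‖Y‖ * (‖u‖ * ‖X‖) + ‖X‖ * ‖Y‖ * (‖u‖ * ‖y‖) := by
          gcongr
      _ = 3 * ‖y‖ * ‖u‖ * ‖X‖ * ‖Y‖ := by ring
  have hwinv : |(w y)⁻¹ - 1| ≤ |M| * ‖y‖⁻¹ := by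
    have hw1 : 1 - w y = -(M / (2 * ‖y‖)) := by simp only [hwdef]; ring
    have h1 : (w y)⁻¹ - 1 = (1 - w y) / w y := by field_simp
    rw [h1, hw1, abs_div, abs_neg, abs_of_pos hwpos, abs_div,
      abs_of_pos (by positivity : (0 : ℝ) < 2 * ‖y‖), div_div, div_le_iff₀ (by positivity)]
    have h2 : |M| * ‖y‖⁻¹ * (2 * ‖y‖ * w y) = |M| * (2 * w y) := by
      field_simp
    rw [h2]
    nlinarith [abs_nonneg M, hw_ge]
  have hmodel : |hessAt G₀ f y X Y - M * (‖y‖ ^ 3)⁻¹ * P| ≤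
      3 * M ^ 2 * (‖y‖ ^ 3)⁻¹ * ‖u‖ * ‖X‖ * ‖Y‖ := by
    rw [hflat]
    have h1 : M * (w y)⁻¹ * (‖y‖ ^ 3)⁻¹ * P - M * (‖y‖ ^ 3)⁻¹ * P =
        M * (‖y‖ ^ 3)⁻¹ * (((w y)⁻¹ - 1) * P) := by ring
    rw [h1, abs_mul, abs_mul, abs_mul, abs_inv, abs_of_pos (pow_pos hypos 3)]
    have h2 : |(w y)⁻¹ - 1| * |P| ≤ (|M| * ‖y‖⁻¹) * (3 * ‖y‖ * ‖u‖ * ‖X‖ * ‖Y‖) :=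
      mul_le_mul hwinv hP (abs_nonneg _) (by positivity)
    have h3 : (|M| * ‖y‖⁻¹) * (3 * ‖y‖ * ‖u‖ * ‖X‖ * ‖Y‖) = 3 * |M| * ‖u‖ * ‖X‖ * ‖Y‖ := by
      field_simp
    rw [h3] at h2
    calc |M| * (‖y‖ ^ 3)⁻¹ * (|(w y)⁻¹ - 1| * |P|)
        ≤ |M| * (‖y‖ ^ 3)⁻¹ * (3 * |M| * ‖u‖ * ‖X‖ * ‖Y‖) := by gcongr
      _ = 3 * M ^ 2 * (‖y‖ ^ 3)⁻¹ * ‖u‖ * ‖X‖ * ‖Y‖ := by rw [← sq_abs M]; ring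
  -- conclusion
  have hsplit' : hessAt G f y X Y - M * (‖y‖ ^ 3)⁻¹ * P =
      (hessAt G f y X Y - hessAt G₀ f y X Y) + (hessAt G₀ f y X Y - M * (‖y‖ ^ 3)⁻¹ * P) := by
    ring
  rw [hsplit']
  refine (abs_add_le _ _).trans ?_
  have hK : (6 * C₀ * (C₂ + C₁) + 3 * C₁) * (‖y‖ ^ 3)⁻¹ * ‖u‖ * ‖X‖ * ‖Y‖ +
      3 * M ^ 2 * (‖y‖ ^ 3)⁻¹ * ‖u‖ * ‖X‖ * ‖Y‖ = K * (‖y‖ ^ 3)⁻¹ * ‖u‖ * ‖X‖ * ‖Y‖ := by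
    rw [hKdef]; ring
  rw [← hK]
  exact add_le_add hpert hmodel

/-- **Schoen–Yau 1979, (2.7), radius form**: there are `C ≥ 0` and `σ ≥ R` such that the estimate
of `eventually_abs_hessAt_hCoeff_inner_sub_le` holds for all `‖y‖ ≥ σ`.
[cite: SchoenYauPMT1979, §2 Step 2, (2.7) (p. 51)] -/
theorem exists_radius_abs_hessAt_hCoeff_inner_sub_le {M : ℝ}
    (hAS : IsAsymptoticallySchwarzschild e D M 2) :
    ∃ C σ : ℝ, 0 ≤ C ∧ e.R ≤ σ ∧ ∀ y : E3, σ ≤ ‖y‖ → ∀ u X Y : E3,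
      |hessAt (hCoeff e D) (fun z : E3 ↦ ⟪u, z⟫) y X Y
          - M * (‖y‖ ^ 3)⁻¹ * (⟪y, X⟫ * ⟪u, Y⟫ + ⟪y, Y⟫ * ⟪u, X⟫ - ⟪X, Y⟫ * ⟪u, y⟫)|
        ≤ C * (‖y‖ ^ 3)⁻¹ * ‖u‖ * ‖X‖ * ‖Y‖ := by
  obtain ⟨C, hC, hev⟩ := e.eventually_abs_hessAt_hCoeff_inner_sub_le D hAS
  obtain ⟨σ₀, hσ₀⟩ := exists_radius_of_eventually hev
  exact ⟨C, max σ₀ e.R, hC, le_max_right _ _, fun y hy ↦ hσ₀ y ((le_max_left _ _).trans hy)⟩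

end AFEnd

end Literature.Geometry.Lorentzian

end
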